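import Summits.ABC.IUTFork.Conditional.WRowN3WholeLevelsM
import Summits.ABC.IUTFork.Cor312HullLicenceLabelZeroM
import Summits.ABC.IUTFork.Conditional.AbcOfSGenuineM
import HarnessLib

/-!
# N3 universe of record, M LINE, ONE NAME FOR BOTH SIDES in the M books' OWN binder shape: «N3 WHOLE — LEVELS FOLDED (hull shape)» —
# the M twin of `WRow.n3_whole_levels_hull` (abc-iut-C-cert-1), i.e. `WRowM.n3_whole_levels_M` with its inhabited conjunct moved to the hull / own-ideles /
# pinned-q shape by the gen-5 M junction

PROOF-ONLY file (D-0012; 0 definitions, 0 `Prop` facts, no instance, no notation) of the abc-iut cell — branch C certificate seat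
abc-iut-C-cert-2 (gen 10), row «C:N3-M-WHOLE-ONE-NAME» file 4. TAKES NO SIDE on [IUTchIII] Cor. 3.12 (S. Mochizuki, *Inter-universal
Teichmüller theory III*, Cor. 3.12 p. 173–174; Step (xi-d) p. 183, (xi-f) p. 184) or on any author; «refuted / inhabited AS TYPED» over OUR
sharp containers ≠ «refuted / asserted in print».

THIS FILE: **`WRowM.n3_whole_levels_hull_M`** — same 37-row `(λ, L₀, p, L⁺)` list literal as `WRowM.n3_whole_levels_M` (`WRowN3WholeLevelsM`) and `WRow.n3_whole_levels`;
for every row, every prime `l ≥ 7`, every genuine Θ-volume datum `T` over `(ratPoint λ, l)`: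
(1) `l ≤ L₀ → l ≠ p →` the M books' per-datum S_H object FAILS (conjunct (1) of `WRowM.n3_whole_levels_M` VERBATIM);
(2) `L⁺ ≤ l →` the SAME per-datum object HOLDS: `Cor312Vol.PilotKummerCompatHull` at
`settingPrVolSharpM T.D (logvAnalyticVal_analyticLogvVal) (tOfIdeleData T.D (ideleDataOf T.D T.isVolumeInputOf)) (tqM … (ideleDataOf …) ·)` with
the pinned q-reading, for every context / Kummer binder — the binder `hSHw` of `Conditional.abc_of_SH_v11M_window` UN-NEGATED, i.e. conjunct (2)
of `WRowM.hex_whole_le_40_hull_M` (abc-iut-W-neg-1 gen 8, `HexWholeLe40HullM`, p553680) VERBATIM. So on the M line the two sides of every N3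
axis face each other in ONE shape across the `(L₀, L⁺)` cut.
PROOF: generic — conjunct (1) is `WRowM.n3_whole_levels_M`'s; conjunct (2) is `WRowM.n3_whole_levels_M`'s licence at `r := ideleDataOf T.D T.isVolumeInputOf`,
`logvK := analyticLogvVal T.K`, `Sq := (GenuineM.finite_ratPlaces_under_S T.D).toFinset` moved through the gen-5 M junction
`Thm311.Real.pilotKummerCompatHull_settingPrVolSharpM_tqM_iff_licence` (`Cor312HullLicenceLabelZeroM`, p485897; needs `5 ≤ l`, here `7 ≤ l`);
no per-row dispatch, nothing re-derived.
HONEST SCOPE: packaging — discharges nothing, changes no census count; admissibility / Szpiro-badness / (P6) / NON-EMPTINESS of the datum type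
NOT claimed; typed ≠ proved; instantiated ≠ endorsed; no abc claim.
[cite: Mochizuki2012, IUTchI Def. 3.1 (b),(c) pp. 61–62, Ex. 3.2 (iv) p. 71; IUTchIII Cor. 3.12 Step (xi-d) p. 183, (xi-f) p. 184; IUTchIV Prop. 1.2 (i)(ii) p. 10, Prop. 1.4 (ii) p. 13, Cor. 2.2 (ii) proof (P5) p. 46]
[cite: DupuyHilado2025, §3.3, §3.4, §4.9, §4.12] [claim: Mochizuki2012, status: disputed] for every IUT sentence quoted.
-/

noncomputable section

open Set Function Metric NumberField IsDedekindDomain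

namespace Summit.ABC.IUTFork.Conditional

open Thm311 Thm311.Real Cor312 Cor312Vol Cor312Prov Literature.IUT.LogThetaLattice Literature.IUT.LogVolume
  Literature.IUT.HodgeTheaters Literature.IUT.LogVolume.Cor22
open Literature.NumberTheory.NumberFields Literature.NumberTheory.GaloisRepresentations.Ultrametric
open Literature.NumberTheory.DiophantineGeometry Literature.NumberTheory.DiophantineGeometry.GenEll

set_option maxHeartbeats 400000 in
/-- **«N3 WHOLE UNDER ONE THEOREM NAME, LEVELS FOLDED», M line, hull shape** — the M twin of `WRow.n3_whole_levels_hull`: same 37-row `(λ, L₀, p, L⁺)` list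
literal; (1) `l ≤ L₀ → l ≠ p →` the M books' per-datum S_H object (own ideles, pinned q-reading) FAILS for every context / Kummer binder;
(2) `L⁺ ≤ l →` the same object HOLDS for every context / Kummer binder (binder `hSHw` of `abc_of_SH_v11M_window` un-negated). From
`WRowM.n3_whole_levels_M` through the gen-5 M junction `pilotKummerCompatHull_settingPrVolSharpM_tqM_iff_licence`. Rows with `L₀ = 0`:
conjunct (1) VACUOUS AS TYPED. Packaging — discharges nothing. [cite: Mochizuki2012, IUTchI Def. 3.1 (b),(c) pp. 61–62, Ex. 3.2 (iv) p. 71; IUTchIII Cor. 3.12 Step (xi-d) p. 183, (xi-f) p. 184; IUTchIV Prop. 1.2 (i)(ii) p. 10, Prop. 1.4 (ii) p. 13, Cor. 2.2 (ii) proof (P5) p. 46]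
[cite: DupuyHilado2025, §3.3, §3.4, §4.9, §4.12] [claim: Mochizuki2012, status: disputed] -/
theorem WRowM.n3_whole_levels_hull_M {q : ℚ} {L0 p Lp l : ℕ}
    (hmem : (q, L0, p, Lp) ∈ ([(((1 : ℕ) : ℚ) / (301327048 : ℕ), 0, 0, 7), (((11 * 103 ^ 8 : ℕ) : ℚ) / (5 ^ 11 * 7 ^ 10 * 79 * 389 ^ 2 : ℕ), 7429469, 103, 7429517), (((13 * 19 ^ 6 : ℕ) : ℚ) / (3 ^ 13 * 11 ^ 2 * 31 : ℕ), 1163, 19, 1171), (((13 ^ 10 * 37 ^ 2 : ℕ) : ℚ) / (2 ^ 26 * 5 ^ 12 * 1873 : ℕ), 114083, 13, 114089), (((13 ^ 5 * 19 ^ 3 : ℕ) : ℚ) / (3 ^ 38 * 397 : ℕ), 8609207, 0, 8609239), (((17 ^ 4 : ℕ) : ℚ) / (3 ^ 9 * 5 ^ 6 * 13 ^ 5 * 23 * 191 : ℕ), 20063, 7, 20071), (((19 * 1307 : ℕ) : ℚ) / (2 ^ 8 * 3 ^ 22 * 5 ^ 4 : ℕ), 59273, 31, 59281), (((2 * 5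 ^ 10 * 13 ^ 4 : ℕ) : ℚ) / (11 ^ 8 * 109 ^ 2 * 3677 ^ 3 : ℕ), 1842, 31, 3709), (((2 : ℕ) : ℚ) / (6436343 : ℕ), 149, 23, 151), (((283 : ℕ) : ℚ) / (8251953408 : ℕ), 0, 0, 7), (((29 ^ 4 * 2213 ^ 2 : ℕ) : ℚ) / (2 ^ 9 * 5 ^ 16 * 11 ^ 9 * 79 : ℕ), 28319539, 23, 28319549), (((2 ^ 11 * 3 ^ 4 * 101 ^ 4 * 29221 : ℕ) : ℚ) / (5 ^ 15 * 17 * 53093 ^ 2 : ℕ), 605971343, 13, 1211942741), (((2 ^ 12 * 13 ^ 3 * 223 ^ 3 : ℕ) : ℚ) / (5 ^ 15 * 179 ^ 4 * 2141 : ℕ), 4079, 0, 6137), (((2 ^ 19 * 367 ^ 3 : ℕ) : ℚ) / (13 ^ 2 * 251 ^ 6 : ℕ), 3148231, 251, 3148259), (((2 ^ 2 * 11 : ℕ) : ℚ) / (5 ^ 9 * 139 ^ 6 : ℕ), 532261, 139, 532267), (((2 ^ 2 * 3 ^ 4 * 163 ^ 3 * 1006151 : ℕ) : ℚ) / (11 ^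 9 * 29 ^ 4 * 101 ^ 3 : ℕ), 402268520, 43, 804537083), (((2 ^ 46 * 23 : ℕ) : ℚ) / (19 ^ 11 * 59 * 7207 : ℕ), 148538, 0, 148540), (((2 ^ 5 * 67 ^ 8 * 107 * 22381 : ℕ) : ℚ) / (3 ^ 22 * 7 ^ 14 * 43 * 83 : ℕ), 1322640, 0, 1322641), (((2 ^ 6 * 5 ^ 2 * 7 ^ 13 * 13 ^ 2 * 463 : ℕ) : ℚ) / (11 ^ 12 * 389 ^ 2 * 6841 : ℕ), 1234870181, 43, 1234870229), (((2 ^ 7 * 23 ^ 8 : ℕ) : ℚ) / (3 ^ 22 * 13 * 47 ^ 2 * 263 : ℕ), 23433, 19, 46897), (((3 * 5 ^ 6 * 7 ^ 8 * 53 : ℕ) : ℚ) / (2 * 11 ^ 6 * 193 ^ 4 * 20551 : ℕ), 153707341, 167, 307414715), (((3 ^ 22 * 9787 ^ 2 : ℕ) : ℚ) / (2 ^ 37 * 89 ^ 3 * 167 ^ 2 * 1823 : ℕ), 6600901, 29, 6600917), (((3 ^ 3 * 241 ^ 3 : ℕ) : ℚ) / (2 ^ 15 * 17 ^ 2 * 331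 * 1061 ^ 4 : ℕ), 69959, 1061, 69991), (((3 ^ 4 * 23 ^ 6 * 1013 ^ 2 : ℕ) : ℚ) / (7 * 131 ^ 7 * 1373 : ℕ), 147583, 131, 147587), (((3 ^ 5 * 5 ^ 15 * 13 ^ 5 : ℕ) : ℚ) / (2 ^ 11 * 73 ^ 7 * 83 ^ 2 * 197 : ℕ), 26003, 73, 26015), (((5 * 67 ^ 3 * 127 ^ 2 * 19219 : ℕ) : ℚ) / (2 * 3 ^ 15 * 7 ^ 2 * 31 ^ 10 : ℕ), 1957753417, 13, 1957753435), (((5 ^ 11 * 31 * 191 : ℕ) : ℚ) / (3 ^ 30 * 13 ^ 4 * 277 : ℕ), 956537, 0, 956545), (((5 ^ 14 * 19 : ℕ) : ℚ) / (11 ^ 7 * 37 ^ 2 * 353 : ℕ), 5853, 7, 11739), (((5 ^ 2 * 23 ^ 10 * 106531 : ℕ) : ℚ) / (2 ^ 4 * 3 ^ 19 * 17 ^ 8 * 29 : ℕ), 2051851, 23, 2051887), (((5 ^ 4 * 19 ^ 13 * 103 : ℕ) : ℚ) / (3 ^ 19 * 11 ^ 4 * 463 ^ 5 : ℕ), 2822719,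 19, 5645475), (((71 ^ 8 * 233 ^ 3 : ℕ) : ℚ) / (3 ^ 38 * 13 ^ 4 * 5233 : ℕ), 8609207, 0, 8609239), (((73 : ℕ) : ℚ) / (5973865915867209 : ℕ), 13, 7, 29), (((7 ^ 11 * 19 : ℕ) : ℚ) / (2 ^ 28 * 3 ^ 12 * 11 ^ 3 * 67 : ℕ), 815, 7, 1663), (((7 ^ 2 * 41 ^ 2 * 311 ^ 3 : ℕ) : ℚ) / (2 * 3 ^ 3 * 5 ^ 23 * 953 : ℕ), 12991207, 11, 12991229), (((7 ^ 3 * 29 ^ 5 * 151 ^ 2 : ℕ) : ℚ) / (3 ^ 27 * 13 ^ 4 : ℕ), 159389, 0, 159395), (((343 : ℕ) : ℚ) / (59392 : ℕ), 0, 0, 5), (((7 ^ 5 * 61 : ℕ) : ℚ) / (3 ^ 13 * 5 ^ 8 * 11 ^ 3 * 53 * 73 ^ 2 * 89 ^ 2 * 103 : ℕ), 836, 7, 1687)] : List (ℚ × ℕ × ℕ × ℕ)))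
    (hl : l.Prime) (h7 : 7 ≤ l) (T : Cor22.ThetaVolumeDatumAt (ratPoint q) l) :
    (l ≤ L0 → l ≠ p →
    letI := T.instFieldF; letI := T.instNumberFieldF; letI := T.instAlgebraF; letI := T.instFieldK
    letI := T.instNumberFieldK; letI := T.instAlgebraK; letI := T.instFieldFbar; letI := T.instAlgebraFbar
    letI := T.instAlgebraKFbar; letI := T.instIsElliptic
    ∀ (M : Type) [Field M] [NumberField M]
      (archPk : ∀ (j : (thetaIndexOfInitial T.D).Label) (vQ : (thetaIndexOfInitial T.D).VQ),
        Set ((logShellsOfInitialDH T.D (analyticLogvVal T.K)).Packet j vQ))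
      (archSub : ∀ (j : (thetaIndexOfInitial T.D).Label) (v : (thetaIndexOfInitial T.D).V),
        Set ((logShellsOfInitialDH T.D (analyticLogvVal T.K)).Packet j ((thetaIndexOfInitial T.D).over v)))
      (Ψ : ℤ → ∀ v : (thetaIndexOfInitial T.D).V, v ∈ (thetaIndexOfInitial T.D).Vbad →
        Set ((logShellsOfInitialDH T.D (analyticLogvVal T.K)).StarPacket v))
      (act : ℤ → ∀ v : (thetaIndexOfInitial T.D).V, v ∈ (thetaIndexOfInitial T.D).Vbad →
        (logShellsOfInitialDH T.D (analyticLogvVal T.K)).StarPacket v →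
          Module.End ℚ ((logShellsOfInitialDH T.D (analyticLogvVal T.K)).StarPacket v))
      (Mmod : ℤ → ∀ j : (thetaIndexOfInitial T.D).LabelStar, Set ((logShellsOfInitialDH T.D (analyticLogvVal T.K)).GlobalPacket j.1))
      (region : ℤ → ∀ j : (thetaIndexOfInitial T.D).LabelStar, FinDivisor M → ∀ vQ : (thetaIndexOfInitial T.D).VQ,
        Set ((logShellsOfInitialDH T.D (analyticLogvVal T.K)).Packet j.1 vQ))
      (frobAdm : ℤ → ℤ → ∀ (j : (thetaIndexOfInitial T.D).Label) (vQ : (thetaIndexOfInitial T.D).VQ),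
        Set ((logShellsOfInitialDH T.D (analyticLogvVal T.K)).Packet j vQ) → Prop)
      (frobLogvol : ℤ → ℤ → ∀ (j : (thetaIndexOfInitial T.D).Label) (vQ : (thetaIndexOfInitial T.D).VQ),
        Set ((logShellsOfInitialDH T.D (analyticLogvVal T.K)).Packet j vQ) → ℝ)
      (frobΨ : ℤ → ℤ → ∀ v : (thetaIndexOfInitial T.D).V, v ∈ (thetaIndexOfInitial T.D).Vbad →
        Set ((logShellsOfInitialDH T.D (analyticLogvVal T.K)).StarPacket v))
      (frobMmod : ℤ → ℤ → ∀ j : (thetaIndexOfInitial T.D).LabelStar, Set ((logShellsOfInitialDH T.D (analyticLogvVal T.K)).GlobalPacket j.1))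
      (unitImage : ℤ → ℤ → ℕ → ∀ (j : (thetaIndexOfInitial T.D).Label) (vQ : (thetaIndexOfInitial T.D).VQ),
        Set ((logShellsOfInitialDH T.D (analyticLogvVal T.K)).Packet j vQ))
      (ballImage : ℤ → ℤ → ∀ (j : (thetaIndexOfInitial T.D).Label) (vQ : (thetaIndexOfInitial T.D).VQ),
        Set ((logShellsOfInitialDH T.D (analyticLogvVal T.K)).Packet j vQ))
      (thetaDiv : ℤ → ℤ → LgpDivisor M (thetaIndexOfInitial T.D).lstar)
      (n : ℤ) {HT : Type} {LogLink : HT → HT → Type} {IsFull : ∀ {s t : HT}, LogLink s t → Prop}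
      (lat : LGPGaussianLogThetaLattice LogLink IsFull)
      {Frd : Type} {IsoF : Frd → Frd → Type} {Ob : Frd → Type} {realify : Frd → Frd} {Strip : Type}
      {IsoS : Strip → Strip → Type} {Mv : ∀ v : (thetaIndexOfInitial T.D).V, v ∈ (thetaIndexOfInitial T.D).Vbad → Type}
      [∀ v h, Monoid (Mv v h)]
      (sig : GlobalLGPFrobenioidSignature (thetaIndexOfInitial T.D).lstar (thetaIndexOfInitial T.D).V
        (· ∈ (thetaIndexOfInitial T.D).Vbad) Frd IsoF Ob realify Strip IsoS Mv)
      (split : SplittingMonoids Mv) {ObΔ : Type} {N : ∀ v : (thetaIndexOfInitial T.D).V, v ∈ (thetaIndexOfInitial T.D).Vbad → Type}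
      [∀ v h, Monoid (N v h)] (qData : QPilotData ObΔ N)
      (qK : ∀ v : (thetaIndexOfInitial T.D).V, v ∈ (thetaIndexOfInitial T.D).Vbad →
        Set ((logShellsOfInitialDH T.D (analyticLogvVal T.K)).StarPacket v)),
      ¬ Cor312Vol.PilotKummerCompatHull
        (LatticeSituation.ofShells (logShellsOfInitialDH T.D (analyticLogvVal T.K)) M archPk archSub
          (summandPiecesPrM T.D (logvAnalyticVal_analyticLogvVal (K := T.K))).Adm (summandPiecesPrM T.D (logvAnalyticVal_analyticLogvVal (K := T.K))).logvol Ψ act Mmod region frobAdm frobLogvol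
          frobΨ frobMmod unitImage ballImage thetaDiv)
        (settingPrVolSharpM T.D (logvAnalyticVal_analyticLogvVal (K := T.K)) (tOfIdeleData T.D (ideleDataOf T.D T.isVolumeInputOf))
          (fun u x => tqM T.D (ratChar u) u (natCast_ratChar_mem u) (ideleDataOf T.D T.isVolumeInputOf) x) M archPk archSub Ψ act Mmod region n lat sig split qData
          (fun u x => tqM_ne_zero T.D (ratChar u) u (natCast_ratChar_mem u) (ideleDataOf T.D T.isVolumeInputOf) x)
          (GenuineM.finite_ratPlaces_under_S T.D).toFinset
          (fun u x hu => norm_tqM_eq_one_of_not_mem T.D (ratChar u) u (natCast_ratChar_mem u) (ideleDataOf T.D T.isVolumeInputOf) x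
            fun hx => hu ((Set.Finite.mem_toFinset _).mpr ⟨x, hx⟩)))
        (fun _ => Cor312.Setting.qRegion
          (settingPrVolSharpM T.D (logvAnalyticVal_analyticLogvVal (K := T.K)) (tOfIdeleData T.D (ideleDataOf T.D T.isVolumeInputOf))
          (fun u x => tqM T.D (ratChar u) u (natCast_ratChar_mem u) (ideleDataOf T.D T.isVolumeInputOf) x) M archPk archSub Ψ act Mmod region n lat sig split qData
          (fun u x => tqM_ne_zero T.D (ratChar u) u (natCast_ratChar_mem u) (ideleDataOf T.D T.isVolumeInputOf) x)
          (GenuineM.finite_ratPlaces_under_S T.D).toFinset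
          (fun u x hu => norm_tqM_eq_one_of_not_mem T.D (ratChar u) u (natCast_ratChar_mem u) (ideleDataOf T.D T.isVolumeInputOf) x
            fun hx => hu ((Set.Finite.mem_toFinset _).mpr ⟨x, hx⟩)))) qK) ∧
    (Lp ≤ l →
    letI := T.instFieldF; letI := T.instNumberFieldF; letI := T.instAlgebraF; letI := T.instFieldK
    letI := T.instNumberFieldK; letI := T.instAlgebraK; letI := T.instFieldFbar; letI := T.instAlgebraFbar
    letI := T.instAlgebraKFbar; letI := T.instIsElliptic
    ∀ (M : Type) [Field M] [NumberField M]
      (archPk : ∀ (j : (thetaIndexOfInitial T.D).Label) (vQ : (thetaIndexOfInitial T.D).VQ),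
        Set ((logShellsOfInitialDH T.D (analyticLogvVal T.K)).Packet j vQ))
      (archSub : ∀ (j : (thetaIndexOfInitial T.D).Label) (v : (thetaIndexOfInitial T.D).V),
        Set ((logShellsOfInitialDH T.D (analyticLogvVal T.K)).Packet j ((thetaIndexOfInitial T.D).over v)))
      (Ψ : ℤ → ∀ v : (thetaIndexOfInitial T.D).V, v ∈ (thetaIndexOfInitial T.D).Vbad →
        Set ((logShellsOfInitialDH T.D (analyticLogvVal T.K)).StarPacket v))
      (act : ℤ → ∀ v : (thetaIndexOfInitial T.D).V, v ∈ (thetaIndexOfInitial T.D).Vbad →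
        (logShellsOfInitialDH T.D (analyticLogvVal T.K)).StarPacket v →
          Module.End ℚ ((logShellsOfInitialDH T.D (analyticLogvVal T.K)).StarPacket v))
      (Mmod : ℤ → ∀ j : (thetaIndexOfInitial T.D).LabelStar, Set ((logShellsOfInitialDH T.D (analyticLogvVal T.K)).GlobalPacket j.1))
      (region : ℤ → ∀ j : (thetaIndexOfInitial T.D).LabelStar, FinDivisor M → ∀ vQ : (thetaIndexOfInitial T.D).VQ,
        Set ((logShellsOfInitialDH T.D (analyticLogvVal T.K)).Packet j.1 vQ))
      (frobAdm : ℤ → ℤ → ∀ (j : (thetaIndexOfInitial T.D).Label) (vQ : (thetaIndexOfInitial T.D).VQ),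
        Set ((logShellsOfInitialDH T.D (analyticLogvVal T.K)).Packet j vQ) → Prop)
      (frobLogvol : ℤ → ℤ → ∀ (j : (thetaIndexOfInitial T.D).Label) (vQ : (thetaIndexOfInitial T.D).VQ),
        Set ((logShellsOfInitialDH T.D (analyticLogvVal T.K)).Packet j vQ) → ℝ)
      (frobΨ : ℤ → ℤ → ∀ v : (thetaIndexOfInitial T.D).V, v ∈ (thetaIndexOfInitial T.D).Vbad →
        Set ((logShellsOfInitialDH T.D (analyticLogvVal T.K)).StarPacket v))
      (frobMmod : ℤ → ℤ → ∀ j : (thetaIndexOfInitial T.D).LabelStar, Set ((logShellsOfInitialDH T.D (analyticLogvVal T.K)).GlobalPacket j.1))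
      (unitImage : ℤ → ℤ → ℕ → ∀ (j : (thetaIndexOfInitial T.D).Label) (vQ : (thetaIndexOfInitial T.D).VQ),
        Set ((logShellsOfInitialDH T.D (analyticLogvVal T.K)).Packet j vQ))
      (ballImage : ℤ → ℤ → ∀ (j : (thetaIndexOfInitial T.D).Label) (vQ : (thetaIndexOfInitial T.D).VQ),
        Set ((logShellsOfInitialDH T.D (analyticLogvVal T.K)).Packet j vQ))
      (thetaDiv : ℤ → ℤ → LgpDivisor M (thetaIndexOfInitial T.D).lstar)
      (n : ℤ) {HT : Type} {LogLink : HT → HT → Type} {IsFull : ∀ {s t : HT}, LogLink s t → Prop}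
      (lat : LGPGaussianLogThetaLattice LogLink IsFull)
      {Frd : Type} {IsoF : Frd → Frd → Type} {Ob : Frd → Type} {realify : Frd → Frd} {Strip : Type}
      {IsoS : Strip → Strip → Type} {Mv : ∀ v : (thetaIndexOfInitial T.D).V, v ∈ (thetaIndexOfInitial T.D).Vbad → Type}
      [∀ v h, Monoid (Mv v h)]
      (sig : GlobalLGPFrobenioidSignature (thetaIndexOfInitial T.D).lstar (thetaIndexOfInitial T.D).V
        (· ∈ (thetaIndexOfInitial T.D).Vbad) Frd IsoF Ob realify Strip IsoS Mv)
      (split : SplittingMonoids Mv) {ObΔ : Type} {N : ∀ v : (thetaIndexOfInitial T.D).V, v ∈ (thetaIndexOfInitial T.D).Vbad → Type}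
      [∀ v h, Monoid (N v h)] (qData : QPilotData ObΔ N)
      (qK : ∀ v : (thetaIndexOfInitial T.D).V, v ∈ (thetaIndexOfInitial T.D).Vbad →
        Set ((logShellsOfInitialDH T.D (analyticLogvVal T.K)).StarPacket v)),
      Cor312Vol.PilotKummerCompatHull
        (LatticeSituation.ofShells (logShellsOfInitialDH T.D (analyticLogvVal T.K)) M archPk archSub
          (summandPiecesPrM T.D (logvAnalyticVal_analyticLogvVal (K := T.K))).Adm (summandPiecesPrM T.D (logvAnalyticVal_analyticLogvVal (K := T.K))).logvol Ψ act Mmod region frobAdm frobLogvol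
          frobΨ frobMmod unitImage ballImage thetaDiv)
        (settingPrVolSharpM T.D (logvAnalyticVal_analyticLogvVal (K := T.K)) (tOfIdeleData T.D (ideleDataOf T.D T.isVolumeInputOf))
          (fun u x => tqM T.D (ratChar u) u (natCast_ratChar_mem u) (ideleDataOf T.D T.isVolumeInputOf) x) M archPk archSub Ψ act Mmod region n lat sig split qData
          (fun u x => tqM_ne_zero T.D (ratChar u) u (natCast_ratChar_mem u) (ideleDataOf T.D T.isVolumeInputOf) x)
          (GenuineM.finite_ratPlaces_under_S T.D).toFinset
          (fun u x hu => norm_tqM_eq_one_of_not_mem T.D (ratChar u) u (natCast_ratChar_mem u) (ideleDataOf T.D T.isVolumeInputOf) x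
            fun hx => hu ((Set.Finite.mem_toFinset _).mpr ⟨x, hx⟩)))
        (fun _ => Cor312.Setting.qRegion
          (settingPrVolSharpM T.D (logvAnalyticVal_analyticLogvVal (K := T.K)) (tOfIdeleData T.D (ideleDataOf T.D T.isVolumeInputOf))
          (fun u x => tqM T.D (ratChar u) u (natCast_ratChar_mem u) (ideleDataOf T.D T.isVolumeInputOf) x) M archPk archSub Ψ act Mmod region n lat sig split qData
          (fun u x => tqM_ne_zero T.D (ratChar u) u (natCast_ratChar_mem u) (ideleDataOf T.D T.isVolumeInputOf) x)
          (GenuineM.finite_ratPlaces_under_S T.D).toFinset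
          (fun u x hu => norm_tqM_eq_one_of_not_mem T.D (ratChar u) u (natCast_ratChar_mem u) (ideleDataOf T.D T.isVolumeInputOf) x
            fun hx => hu ((Set.Finite.mem_toFinset _).mpr ⟨x, hx⟩)))) qK) := by
  refine ⟨(WRowM.n3_whole_levels_M hmem hl h7 T).1, fun hLp => ?_⟩
  intro M _ _ archPk archSub Ψ act Mmod region frobAdm frobLogvol frobΨ frobMmod unitImage ballImage thetaDiv n HT LogLink IsFull lat
    Frd IsoF Ob realify Strip IsoS Mv _ sig split ObΔ N _ qData qK
  letI := T.instFieldF; letI := T.instNumberFieldF; letI := T.instAlgebraF; letI := T.instFieldK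
  letI := T.instNumberFieldK; letI := T.instAlgebraK; letI := T.instFieldFbar; letI := T.instAlgebraFbar
  letI := T.instAlgebraKFbar; letI := T.instIsElliptic
  exact (pilotKummerCompatHull_settingPrVolSharpM_tqM_iff_licence T.D (logvAnalyticVal_analyticLogvVal (K := T.K)) M
    archPk archSub Ψ act Mmod region n lat sig split qData (tOfIdeleData T.D (ideleDataOf T.D T.isVolumeInputOf)) (ideleDataOf T.D T.isVolumeInputOf)
    (GenuineM.finite_ratPlaces_under_S T.D).toFinset
    (fun u x hu => norm_tqM_eq_one_of_not_mem T.D (ratChar u) u (natCast_ratChar_mem u) (ideleDataOf T.D T.isVolumeInputOf) x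
      fun hx => hu ((Set.Finite.mem_toFinset _).mpr ⟨x, hx⟩))
    frobAdm frobLogvol frobΨ frobMmod unitImage ballImage thetaDiv qK).2
    ((WRowM.n3_whole_levels_M hmem hl h7 T).2 hLp (logvAnalyticVal_analyticLogvVal (K := T.K)) (ideleDataOf T.D T.isVolumeInputOf) M
      archPk archSub Ψ act Mmod region n lat sig split qData _ _ _)

end Summit.ABC.IUTFork.Conditional

end
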